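import Mathlib
import Summits.MatrixMultiplication.MatrixMultiplication.Theses.FourierTwoFamiliesModP

/-!
# `PrimeTwoFamilies ↔` cyclic ladders — an explicit, elementary, self-contained proof

Crux `stmt-MatrixMultiplication-14308` (`FourierTwoFamiliesModP.PrimeTwoFamilies`, CKSU 2005 Conj. 4.7 with prime
cyclic hosts), registered stub `primeTwoFamilies_iff_cyclicLadder`: the crux holds iff the CYCLIC LADDER CONJECTURE
holds — for every `ε > 0` and arbitrarily large `m` there are classes `(X c, Y c)_{c < r}` in `ℤ/m` with (i) every
class direct, (ii) for `p < q` every lower cross difference `y' - x'` (`x' ∈ X p`, `y' ∈ Y q`) different from every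
diagonal difference `y - x` (`x ∈ X c`, `y ∈ Y c`), `m ^ (1/2 - ε) ≤ r` and `m ^ (1 - ε) ≤ |X c| |Y c|`.

This file is a SECOND, INDEPENDENT proof of the equivalence first landed as
`Theorems.PrimeTwoFamilies.LadderLift.primeTwoFamilies_iff_cyclicLadder` (composition of the line's stubs with the
product-group transfer `exists_prime_sdpp_of_addEquiv`).  Here everything is explicit and elementary, and the only
imports are Mathlib and the route file.
* (⇐) For the slice `δ = 1/K` (`K ≥ 2`) take a ladder level `m` at `ε = 1/(12K)`, words of length `L = 14K + 6`
  over the classes with one popular digit sum (`r ^ (L-1) ≤ L · N`, pigeonhole), `n = m ^ (7K) ≤ N` of them, and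
  embed `(ℤ/m)^L` into `ℤ/p` by BASE-`4m` DIGITS (`x ↦ ∑ₜ x̃ₜ (4m)^t`, `x̃ₜ ∈ [0, m)` the representative) for a
  Bertrand prime `(4m)^L < p ≤ 2 (4m)^L`: a relation `(a - a') + (b - b') = 0` in `ℤ/p` has balanced digits
  `|dₜ| < 2m`, so it lifts to `ℤ` (`2|D| < (4m)^L < p`) and then holds digit by digit (`digits_eq_zero`);
  coordinatewise, ladder clause (i) gives (W), and clause (ii) gives `w_k ≤ w_i` pointwise for the index words,
  which with equal digit sums forces `w_i = w_k`, i.e. (X).  Exponents: `p ≤ 2·4^L·m^L ≤ m^(14K+7) = n^(2+1/K)`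
  and `n^(2-1/K) = m^(14K-7) ≤ (m^(1-ε))^L ≤ |A i| |B i|`; slices are monotone in `δ ≥ 1/K` since `n ≥ 1`.
* (⇒) An SDPP witness `(A i, B i)_{i<n}` in `ℤ/p` of the slice `δ = min ε (1/4)` is a ladder in any order with
  `m = p`, `r = n`; `p ≤ n^(2+δ)` and `n^(2-δ) ≤ |A i| |B i| ≤ p` (directness) give the exponents and `p ≥ m₀`.
-/

-- single-conjunct summit: the mandated namespace repeats `MatrixMultiplication` (summit = sub-problem).
set_option linter.dupNamespace false

namespace Summit.MatrixMultiplication.MatrixMultiplication.Theorems.PrimeTwoFamilies.LadderElementary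

open Finset
open Summit.MatrixMultiplication.MatrixMultiplication.Theses

/-! ## Balanced base-`M` digits and the digit embedding `(ℤ/m)^L → ℤ/p` -/

/-- Peeling off the lowest digit: `∑_{t ≤ L} dₜ M^t = d₀ + (∑_{t < L} d_{t+1} M^t) · M`. -/
private theorem sum_digits_succ {L : ℕ} (M : ℤ) (d : Fin (L + 1) → ℤ) :
    ∑ t, d t * M ^ (t : ℕ) = d 0 + (∑ t : Fin L, d t.succ * M ^ (t : ℕ)) * M := by
  rw [Fin.sum_univ_succ, Finset.sum_mul]
  simp only [Fin.val_zero, pow_zero, mul_one, Fin.val_succ, pow_succ, mul_assoc]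

/-- Balanced digit expansions are small: if `2 |dₜ| < M` for all `t < L` then `2 |∑ₜ dₜ M^t| < M^L`. -/
theorem two_mul_abs_digits_lt {M : ℤ} :
    ∀ {L : ℕ} (d : Fin L → ℤ), (∀ t, 2 * |d t| < M) → 2 * |∑ t, d t * M ^ (t : ℕ)| < M ^ L
  | 0, _, _ => by simp
  | L + 1, d, hd => by
    have IH : 2 * |∑ t : Fin L, d t.succ * M ^ (t : ℕ)| + 1 ≤ M ^ L :=
      two_mul_abs_digits_lt (fun t => d t.succ) fun t => hd t.succ
    have h0 := hd 0
    have hM : 0 ≤ M := by linarith [abs_nonneg (d 0)]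
    rw [sum_digits_succ, pow_succ]
    have htri : |d 0 + (∑ t : Fin L, d t.succ * M ^ (t : ℕ)) * M| ≤
        |d 0| + |∑ t : Fin L, d t.succ * M ^ (t : ℕ)| * M := by
      calc _ ≤ |d 0| + |(∑ t : Fin L, d t.succ * M ^ (t : ℕ)) * M| := abs_add_le _ _
        _ = _ := by rw [abs_mul, abs_of_nonneg hM]
    linarith [mul_le_mul_of_nonneg_right IH hM]

/-- Balanced digit expansions are unique: if `2 |dₜ| < M` for all `t < L` and `∑ₜ dₜ M^t = 0` then every digit
vanishes (no carries can occur). -/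
theorem digits_eq_zero {M : ℤ} :
    ∀ {L : ℕ} (d : Fin L → ℤ), (∀ t, 2 * |d t| < M) → ∑ t, d t * M ^ (t : ℕ) = 0 → ∀ t, d t = 0
  | 0, _, _, _, t => t.elim0
  | L + 1, d, hd, h, t => by
    rw [sum_digits_succ] at h
    have h0 := hd 0
    have hMpos : 0 < M := by linarith [abs_nonneg (d 0)]
    have hd0 : d 0 = 0 := by
      refine Int.eq_zero_of_abs_lt_dvd (m := M) ⟨-(∑ t : Fin L, d t.succ * M ^ (t : ℕ)), ?_⟩ ?_
      · linear_combination h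
      · linarith [abs_nonneg (d 0)]
    have hrest : ∑ t : Fin L, d t.succ * M ^ (t : ℕ) = 0 := by
      rw [hd0, zero_add] at h
      exact (mul_eq_zero.1 h).resolve_right hMpos.ne'
    exact Fin.cases hd0 (digits_eq_zero (fun t => d t.succ) (fun t => hd t.succ) hrest) t

/-- **No carries.**  Write `E x := ∑ₜ x̃ₜ (4m)^t (mod p)` for `x : Fin L → ZMod m`, `x̃ₜ ∈ [0, m)` the
representative of `x t`.  If `(4m)^L < p` then a relation `(E x - E x') + (E y - E y') = 0` in `ZMod p` holds
coordinatewise in `ZMod m`: the integer `∑ₜ dₜ (4m)^t`, `dₜ = x̃ₜ - x̃'ₜ + ỹₜ - ỹ'ₜ`, has balanced digits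
`2|dₜ| < 4m`, so it is `< p` in absolute value, hence zero, hence zero digit by digit. -/
theorem coord_eq_of_emb_eq {m : ℕ} [NeZero m] {L p : ℕ} (hp : (4 * m) ^ L < p)
    (x x' y y' : Fin L → ZMod m)
    (h : ((∑ t, (x t).val * (4 * m) ^ (t : ℕ) : ℕ) : ZMod p)
          - ((∑ t, (x' t).val * (4 * m) ^ (t : ℕ) : ℕ) : ZMod p)
        + (((∑ t, (y t).val * (4 * m) ^ (t : ℕ) : ℕ) : ZMod p)
          - ((∑ t, (y' t).val * (4 * m) ^ (t : ℕ) : ℕ) : ZMod p)) = 0)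
    (t : Fin L) : (x t - x' t) + (y t - y' t) = 0 := by
  -- the balanced digits of the relation
  set d : Fin L → ℤ := fun t => (((x t).val : ℤ) - (x' t).val) + (((y t).val : ℤ) - (y' t).val)
    with hd
  have hdM : ∀ t, 2 * |d t| < 4 * (m : ℤ) := fun t => by
    have h1 := ZMod.val_lt (x t); have h2 := ZMod.val_lt (x' t)
    have h3 := ZMod.val_lt (y t); have h4 := ZMod.val_lt (y' t)
    have : |d t| < 2 * (m : ℤ) := abs_lt.2 ⟨by simp only [hd]; omega, by simp only [hd]; omega⟩
    linarith
  -- the integer digit sum vanishes mod `p`, and is `< p` in absolute value, so it vanishes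
  have hD : ∑ t, d t * (4 * (m : ℤ)) ^ (t : ℕ) = 0 := by
    have hcast : ((∑ t, d t * (4 * (m : ℤ)) ^ (t : ℕ) : ℤ) : ZMod p) = 0 := by
      have e : ∑ t, d t * (4 * (m : ℤ)) ^ (t : ℕ) =
          ((∑ t, (x t).val * (4 * m) ^ (t : ℕ) : ℕ) : ℤ) - ((∑ t, (x' t).val * (4 * m) ^ (t : ℕ) : ℕ) : ℤ)
          + (((∑ t, (y t).val * (4 * m) ^ (t : ℕ) : ℕ) : ℤ)
            - ((∑ t, (y' t).val * (4 * m) ^ (t : ℕ) : ℕ) : ℤ)) := by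
        push_cast
        simp only [hd, add_mul, sub_mul, Finset.sum_add_distrib, Finset.sum_sub_distrib]
      rw [e]
      push_cast at h ⊢
      exact h
    haveI : NeZero p := ⟨by omega⟩
    refine Int.eq_zero_of_abs_lt_dvd ((ZMod.intCast_zmod_eq_zero_iff_dvd _ p).1 hcast) ?_
    have hlt := two_mul_abs_digits_lt d hdM
    have hp' : (4 * (m : ℤ)) ^ L < (p : ℤ) := by exact_mod_cast hp
    linarith [abs_nonneg (∑ t, d t * (4 * (m : ℤ)) ^ (t : ℕ))]
  -- digit `t` vanishes in `ℤ`, hence in `ZMod m`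
  have hdt := congrArg (Int.cast : ℤ → ZMod m) (digits_eq_zero d hdM hD t)
  simp only [hd] at hdt
  push_cast at hdt
  simpa using hdt

/-! ## Constant-weight words over a ladder, embedded in `ℤ/p` -/

/-- **The lift.**  Let `(X c, Y c)_{c<r}` be a ladder in `ZMod m` ((i) `hW`: classes direct; (ii) `hL`: lower cross
differences avoid diagonal differences), `w : Fin n → (Fin L → Fin r)` an injective family of index words of one
digit sum `S`, and `(4m)^L < p`.  Then the digit-embedded products `A i = E(∏ₜ X (w i t))`, `B i = E(∏ₜ Y (w i t))`
form an SDPP family in `ZMod p` — clauses (W) and (X) of CKSU Def. 4.1 exactly as inlined in the crux — of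
co-volume `∏ₜ |X (w i t)| |Y (w i t)|`. -/
theorem lift {m : ℕ} [NeZero m] {r L n S p : ℕ} (X Y : Fin r → Finset (ZMod m))
    (hW : ∀ c : Fin r, ∀ x ∈ X c, ∀ x' ∈ X c, ∀ y ∈ Y c, ∀ y' ∈ Y c, (x - x') + (y - y') = 0 → x = x' ∧ y = y')
    (hL : ∀ c p q : Fin r, p < q → ∀ x ∈ X c, ∀ y ∈ Y c, ∀ x' ∈ X p, ∀ y' ∈ Y q, y - x ≠ y' - x')
    (w : Fin n → Fin L → Fin r) (hw : Function.Injective w) (hS : ∀ i, ∑ t, ((w i t : ℕ)) = S)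
    (hp : (4 * m) ^ L < p) :
    ∃ A B : Fin n → Finset (ZMod p),
      (∀ i, ∀ a ∈ A i, ∀ a' ∈ A i, ∀ b ∈ B i, ∀ b' ∈ B i, (a - a') + (b - b') = 0 → a = a' ∧ b = b') ∧
      (∀ i j k, ∀ a ∈ A i, ∀ a' ∈ A j, ∀ b ∈ B j, ∀ b' ∈ B k, (a - a') + (b - b') = 0 → i = k) ∧
      ∀ i, (A i).card = ∏ t, (X (w i t)).card ∧ (B i).card = ∏ t, (Y (w i t)).card := by
  -- the digit embedding and its two properties
  let E : (Fin L → ZMod m) → ZMod p := fun x => ((∑ t, (x t).val * (4 * m) ^ (t : ℕ) : ℕ) : ZMod p)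
  have hE : ∀ x x' y y', (E x - E x') + (E y - E y') = 0 → ∀ t, (x t - x' t) + (y t - y' t) = 0 :=
    fun x x' y y' h t => coord_eq_of_emb_eq hp x x' y y' h t
  have hEinj : Function.Injective E := fun x x' h => funext fun t => by
    have := hE x x' 0 0 (by rw [h, sub_self, sub_self, add_zero]) t
    simpa [sub_eq_zero] using this
  refine ⟨fun i => (Fintype.piFinset fun t => X (w i t)).image E,
    fun i => (Fintype.piFinset fun t => Y (w i t)).image E, ?_, ?_, fun i => ?_⟩
  · -- (W): coordinatewise, by ladder clause (i)
    intro i a ha a' ha' b hb b' hb' h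
    simp only [Finset.mem_image, Fintype.mem_piFinset] at ha ha' hb hb'
    obtain ⟨x, hx, rfl⟩ := ha; obtain ⟨x', hx', rfl⟩ := ha'
    obtain ⟨y, hy, rfl⟩ := hb; obtain ⟨y', hy', rfl⟩ := hb'
    have key := hE x x' y y' h
    have hxy : ∀ t, x t = x' t ∧ y t = y' t := fun t => hW _ _ (hx t) _ (hx' t) _ (hy t) _ (hy' t) (key t)
    exact ⟨congrArg E (funext fun t => (hxy t).1), congrArg E (funext fun t => (hxy t).2)⟩
  · -- (X): coordinatewise, ladder clause (ii) gives `w k ≤ w i`; equal digit sums give `w i = w k`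
    intro i j k a ha a' ha' b hb b' hb' h
    simp only [Finset.mem_image, Fintype.mem_piFinset] at ha ha' hb hb'
    obtain ⟨x, hx, rfl⟩ := ha; obtain ⟨x', hx', rfl⟩ := ha'
    obtain ⟨y, hy, rfl⟩ := hb; obtain ⟨y', hy', rfl⟩ := hb'
    have key := hE x x' y y' h
    have hle : ∀ t ∈ (univ : Finset (Fin L)), ((w k t : ℕ)) ≤ ((w i t : ℕ)) := fun t _ =>
      Fin.le_def.1 <| not_lt.1 fun hlt =>
        hL (w j t) (w i t) (w k t) hlt (x' t) (hx' t) (y t) (hy t) (x t) (hx t) (y' t) (hy' t)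
          (by linear_combination key t)
    have heq := (Finset.sum_eq_sum_iff_of_le hle).1 ((hS k).trans (hS i).symm)
    exact hw (funext fun t => Fin.ext (heq t (mem_univ t)).symm)
  · -- co-volume
    simp only [Finset.card_image_of_injective _ hEinj, Fintype.card_piFinset, and_self]

/-- **Pigeonhole on digit sums.**  Among the `r ^ L` words `Fin L → Fin r` (`r, L ≥ 1`) some digit sum `S < L r` is
attained by at least `r ^ L / (L r)` words: `r ^ L ≤ L · r · #{w | ∑ w = S}`. -/
theorem exists_popular_digit_sum (r L : ℕ) (hr : 1 ≤ r) (hL : 1 ≤ L) :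
    ∃ S : ℕ, r ^ L ≤ L * r * (univ.filter fun w : Fin L → Fin r => ∑ t, ((w t : ℕ)) = S).card := by
  have hmaps : ∀ w ∈ (univ : Finset (Fin L → Fin r)),
      (fun w : Fin L → Fin r => ∑ t, ((w t : ℕ))) w ∈ range (L * r) := fun w _ => by
    rw [mem_range]
    calc ∑ t, ((w t : ℕ)) < ∑ _t : Fin L, r := sum_lt_sum_of_nonempty ⟨⟨0, hL⟩, mem_univ _⟩ fun t _ => (w t).isLt
      _ = L * r := by simp
  obtain ⟨S, -, hmax⟩ := exists_max_image (range (L * r))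
    (fun S => (univ.filter fun w : Fin L → Fin r => ∑ t, ((w t : ℕ)) = S).card) ⟨0, mem_range.2 (Nat.mul_pos hL hr)⟩
  refine ⟨S, ?_⟩
  calc r ^ L = (univ : Finset (Fin L → Fin r)).card := by simp
    _ = ∑ S' ∈ range (L * r), (univ.filter fun w : Fin L → Fin r => ∑ t, ((w t : ℕ)) = S').card :=
        card_eq_sum_card_fiberwise hmaps
    _ ≤ (range (L * r)).card • (univ.filter fun w : Fin L → Fin r => ∑ t, ((w t : ℕ)) = S).card :=
        sum_le_card_nsmul _ _ _ hmax
    _ = L * r * _ := by rw [card_range, smul_eq_mul]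

/-! ## The slice `δ = 1/K` from one ladder level, and the equivalence -/

/-- **One ladder level gives the slice `1/K`.**  Let `K ≥ 2`, `L = 14K + 6`, and let `(X c, Y c)_{c<r}` be a ladder
in `ZMod m` with `m ^ (1/2 - 1/(12K)) ≤ r` classes of co-volume `m ^ (1 - 1/(12K)) ≤ |X c| |Y c|`, at a level
`m ≥ max (2 · 4^L) L`.  Then `n = m ^ (7K)` pairs in `ZMod p`, `p` a prime in `((4m)^L, 2 (4m)^L]`, witness the
slice: (W), (X), `p ≤ n ^ (2 + 1/K)` and `n ^ (2 - 1/K) ≤ |A i| |B i|`. -/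
theorem slice_of_ladder {K m r : ℕ} (hK : 2 ≤ K) [NeZero m] (X Y : Fin r → Finset (ZMod m))
    (hW : ∀ c : Fin r, ∀ x ∈ X c, ∀ x' ∈ X c, ∀ y ∈ Y c, ∀ y' ∈ Y c, (x - x') + (y - y') = 0 → x = x' ∧ y = y')
    (hL : ∀ c p q : Fin r, p < q → ∀ x ∈ X c, ∀ y ∈ Y c, ∀ x' ∈ X p, ∀ y' ∈ Y q, y - x ≠ y' - x')
    (hr : (m : ℝ) ^ (1 / 2 - 1 / (12 * (K : ℝ))) ≤ (r : ℝ))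
    (hP : ∀ c : Fin r, (m : ℝ) ^ (1 - 1 / (12 * (K : ℝ))) ≤ (((X c).card * (Y c).card : ℕ) : ℝ))
    (hm4 : 2 * 4 ^ (14 * K + 6) ≤ m) (hmL : 14 * K + 6 ≤ m) :
    ∃ p : ℕ, p.Prime ∧ ∃ A B : Fin (m ^ (7 * K)) → Finset (ZMod p),
      (∀ i, ∀ a ∈ A i, ∀ a' ∈ A i, ∀ b ∈ B i, ∀ b' ∈ B i, (a - a') + (b - b') = 0 → a = a' ∧ b = b') ∧
      (∀ i j k, ∀ a ∈ A i, ∀ a' ∈ A j, ∀ b ∈ B j, ∀ b' ∈ B k, (a - a') + (b - b') = 0 → i = k) ∧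
      (p : ℝ) ≤ ((m ^ (7 * K) : ℕ) : ℝ) ^ (2 + 1 / (K : ℝ)) ∧
      ∀ i, ((m ^ (7 * K) : ℕ) : ℝ) ^ (2 - 1 / (K : ℝ)) ≤ (((A i).card * (B i).card : ℕ) : ℝ) := by
  have hK0 : (0 : ℝ) < K := by exact_mod_cast (by omega : 0 < K)
  have hK2 : (2 : ℝ) ≤ K := by exact_mod_cast hK
  have hK0' : (K : ℝ) ≠ 0 := hK0.ne'
  have hm1 : 1 ≤ m := by omega
  have hm0R : (0 : ℝ) ≤ m := Nat.cast_nonneg m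
  have hm1R : (1 : ℝ) ≤ m := by exact_mod_cast hm1
  have hr1 : 1 ≤ r := by
    have h : (0 : ℝ) < r := lt_of_lt_of_le (Real.rpow_pos_of_pos (Nat.cast_pos.2 hm1) _) hr
    exact_mod_cast h
  -- a popular digit sum `S` among the words of length `L = 14K + 6`
  obtain ⟨S, hS⟩ := exists_popular_digit_sum r (14 * K + 6) hr1 (by omega)
  set W := univ.filter fun w : Fin (14 * K + 6) → Fin r => ∑ t, ((w t : ℕ)) = S
  -- `m ^ (7K) ≤ #W`: `L · m^(7K) ≤ m^(7K+1) ≤ r^(14K+5) ≤ L · #W`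
  have hexp : ((7 * K + 1 : ℕ) : ℝ) ≤ (1 / 2 - 1 / (12 * (K : ℝ))) * ((14 * K + 5 : ℕ) : ℝ) := by
    rw [← sub_nonneg]
    have e : (1 / 2 - 1 / (12 * (K : ℝ))) * ((14 * K + 5 : ℕ) : ℝ) - ((7 * K + 1 : ℕ) : ℝ)
        = (4 * (K : ℝ) - 5) / (12 * K) := by push_cast; field_simp; ring
    rw [e]
    exact div_nonneg (by linarith) (by positivity)
  have hmr : m ^ (7 * K + 1) ≤ r ^ (14 * K + 5) := by
    have h : (m : ℝ) ^ (7 * K + 1) ≤ (r : ℝ) ^ (14 * K + 5) := by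
      calc (m : ℝ) ^ (7 * K + 1) = (m : ℝ) ^ (((7 * K + 1 : ℕ)) : ℝ) := (Real.rpow_natCast _ _).symm
        _ ≤ (m : ℝ) ^ ((1 / 2 - 1 / (12 * (K : ℝ))) * ((14 * K + 5 : ℕ) : ℝ)) :=
            Real.rpow_le_rpow_of_exponent_le hm1R hexp
        _ = ((m : ℝ) ^ (1 / 2 - 1 / (12 * (K : ℝ)))) ^ (14 * K + 5) := by rw [Real.rpow_mul hm0R, Real.rpow_natCast]
        _ ≤ (r : ℝ) ^ (14 * K + 5) := pow_le_pow_left₀ (Real.rpow_nonneg hm0R _) hr _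
    exact_mod_cast h
  have hN : m ^ (7 * K) ≤ W.card := by
    have h1 : r ^ (14 * K + 5) * r ≤ (14 * K + 6) * W.card * r := by
      calc r ^ (14 * K + 5) * r = r ^ (14 * K + 6) := by ring
        _ ≤ (14 * K + 6) * r * W.card := hS
        _ = (14 * K + 6) * W.card * r := by ring
    have h3 : (14 * K + 6) * m ^ (7 * K) ≤ (14 * K + 6) * W.card := by
      calc (14 * K + 6) * m ^ (7 * K) ≤ m * m ^ (7 * K) := Nat.mul_le_mul_right _ hmL
        _ = m ^ (7 * K + 1) := by ring
        _ ≤ r ^ (14 * K + 5) := hmr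
        _ ≤ (14 * K + 6) * W.card := Nat.le_of_mul_le_mul_right h1 hr1
    exact Nat.le_of_mul_le_mul_left h3 (by omega)
  -- `m ^ (7K)` distinct words of digit sum `S`
  let w : Fin (m ^ (7 * K)) → Fin (14 * K + 6) → Fin r := fun i => (W.equivFin.symm (Fin.castLE hN i) : W)
  have hw : Function.Injective w := fun i j h =>
    Fin.castLE_injective hN (W.equivFin.symm.injective (Subtype.val_injective h))
  have hwS : ∀ i, ∑ t, ((w i t : ℕ)) = S := fun i => (Finset.mem_filter.1 (W.equivFin.symm (Fin.castLE hN i)).2).2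
  -- a Bertrand prime above `(4m)^L`, and the lift
  obtain ⟨p, hp, hlt, hle⟩ :=
    Nat.exists_prime_lt_and_le_two_mul ((4 * m) ^ (14 * K + 6)) (pow_pos (by omega) _).ne'
  obtain ⟨A, B, hWA, hXA, hcard⟩ := lift X Y hW hL w hw hwS hlt
  have hn1 : (1 : ℝ) ≤ ((m ^ (7 * K) : ℕ) : ℝ) := by exact_mod_cast Nat.one_le_pow _ _ hm1
  refine ⟨p, hp, A, B, hWA, hXA, ?_, fun i => ?_⟩
  · -- `p ≤ 2 · 4^L · m^L ≤ m^(14K+7) = n^(2 + 1/K)`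
    have h1 : p ≤ m ^ (14 * K + 7) := by
      calc p ≤ 2 * (4 * m) ^ (14 * K + 6) := hle
        _ = 2 * 4 ^ (14 * K + 6) * m ^ (14 * K + 6) := by rw [mul_pow]; ring
        _ ≤ m * m ^ (14 * K + 6) := Nat.mul_le_mul_right _ hm4
        _ = m ^ (14 * K + 7) := by ring
    have h2 : ((m ^ (7 * K) : ℕ) : ℝ) ^ (2 + 1 / (K : ℝ)) = ((m ^ (14 * K + 7) : ℕ) : ℝ) := by
      push_cast
      rw [← Real.rpow_natCast (m : ℝ) (7 * K), ← Real.rpow_mul hm0R, ← Real.rpow_natCast (m : ℝ) (14 * K + 7)]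
      congr 1
      push_cast; field_simp; ring
    rw [h2]
    exact_mod_cast h1
  · -- `n^(2 - 1/K) = m^(14K-7) ≤ (m^(1-ε))^L ≤ ∏ₜ |X (w i t)| |Y (w i t)| = |A i| |B i|`
    have h2 : ((m ^ (7 * K) : ℕ) : ℝ) ^ (2 - 1 / (K : ℝ)) = (m : ℝ) ^ (14 * (K : ℝ) - 7) := by
      push_cast
      rw [← Real.rpow_natCast (m : ℝ) (7 * K), ← Real.rpow_mul hm0R]
      congr 1
      push_cast; field_simp; ring
    have h3 : (14 * (K : ℝ) - 7) ≤ (1 - 1 / (12 * (K : ℝ))) * ((14 * K + 6 : ℕ) : ℝ) := by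
      rw [← sub_nonneg]
      have e : (1 - 1 / (12 * (K : ℝ))) * ((14 * K + 6 : ℕ) : ℝ) - (14 * (K : ℝ) - 7)
          = (142 * (K : ℝ) - 6) / (12 * K) := by push_cast; field_simp; ring
      rw [e]
      exact div_nonneg (by linarith) (by positivity)
    have h4 : (m : ℝ) ^ (14 * (K : ℝ) - 7) ≤ ((m : ℝ) ^ (1 - 1 / (12 * (K : ℝ)))) ^ (14 * K + 6) := by
      rw [← Real.rpow_natCast, ← Real.rpow_mul hm0R]
      exact Real.rpow_le_rpow_of_exponent_le hm1R h3
    have h5 : ((m : ℝ) ^ (1 - 1 / (12 * (K : ℝ)))) ^ (14 * K + 6) ≤ (((A i).card * (B i).card : ℕ) : ℝ) := by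
      rw [(hcard i).1, (hcard i).2]
      push_cast
      rw [← Finset.prod_mul_distrib, ← Fin.prod_const]
      exact Finset.prod_le_prod (fun t _ => by positivity) fun t _ => by exact_mod_cast hP (w i t)
    rw [h2]
    exact h4.trans h5

/-- **`PrimeTwoFamilies ↔` the cyclic ladder conjecture** (crux stmt-MatrixMultiplication-14308, registered stub
`primeTwoFamilies_iff_cyclicLadder`; explicit elementary proof, independent of
`LadderLift.primeTwoFamilies_iff_cyclicLadder`).  CKSU Conj. 4.7 with prime cyclic hosts holds iff for every `ε > 0`
there are arbitrarily large `m` and ladders in `ZMod m` — (i) every class direct, (ii) lower cross differences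
(`p < q`) avoiding all diagonal differences — with `m^(1/2-ε) ≤ r` classes of co-volume `m^(1-ε) ≤ |X c| |Y c|`.
(⇒) an SDPP witness of the slice `min ε (1/4)` is a ladder in any order (clause (X) at `(i, j, k) = (p, c, q)`),
with `m = p ≥ |A i| |B i| ≥ n ≥ m₀` by directness.  (⇐) `slice_of_ladder` at `K = max 2 ⌈1/δ⌉₊` (base-`4m` digit
embedding of constant-weight words into a Bertrand prime), then monotonicity of the slice in `δ ≥ 1/K`. -/
theorem primeTwoFamilies_iff_cyclicLadder :
    FourierTwoFamiliesModP.PrimeTwoFamilies ↔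
    (∀ ε : ℝ, 0 < ε → ∀ m₀ : ℕ, ∃ m ≥ m₀, ∃ r : ℕ, ∃ X Y : Fin r → Finset (ZMod m),
      ((∀ c : Fin r, ∀ x ∈ X c, ∀ x' ∈ X c, ∀ y ∈ Y c, ∀ y' ∈ Y c,
          (x - x') + (y - y') = 0 → x = x' ∧ y = y') ∧
        (∀ c p q : Fin r, p < q → ∀ x ∈ X c, ∀ y ∈ Y c, ∀ x' ∈ X p, ∀ y' ∈ Y q,
          y - x ≠ y' - x')) ∧
      (m : ℝ) ^ (1 / 2 - ε) ≤ (r : ℝ) ∧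
      ∀ c : Fin r, (m : ℝ) ^ (1 - ε) ≤ (((X c).card * (Y c).card : ℕ) : ℝ)) := by
  refine ⟨fun hT ε hε m₀ => ?_, fun hC δ hδ n₀ => ?_⟩
  · /- (⇒): an SDPP witness of the slice `ε' = min ε (1/4)` is a ladder -/
    set ε' : ℝ := min ε (1 / 4)
    have hε' : 0 < ε' := lt_min hε (by norm_num)
    have hε'ε : ε' ≤ ε := min_le_left _ _; have hε'4 : ε' ≤ 1 / 4 := min_le_right _ _
    obtain ⟨n, hn, p, hp, A, B, hW, hX, hpn, hAB⟩ := hT ε' hε' (max m₀ 1)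
    haveI : NeZero p := ⟨hp.ne_zero⟩
    have hn1 : 1 ≤ n := le_trans (le_max_right _ _) hn
    have hn1R : (1 : ℝ) ≤ n := by exact_mod_cast hn1
    have hn0 : (0 : ℝ) ≤ n := Nat.cast_nonneg n; have hp0 : (0 : ℝ) ≤ p := Nat.cast_nonneg p
    have hp1 : (1 : ℝ) ≤ p := by exact_mod_cast hp.one_lt.le
    -- directness: `|A i| |B i| ≤ p`
    have hdir : ∀ i, (A i).card * (B i).card ≤ p := fun i => by
      rw [← Finset.card_product]
      calc (A i ×ˢ B i).card ≤ (univ : Finset (ZMod p)).card :=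
            Finset.card_le_card_of_injOn (fun ab => ab.1 + ab.2) (fun _ _ => mem_univ _) ?_
        _ = p := by rw [Finset.card_univ, ZMod.card]
      rintro ⟨a, b⟩ hab ⟨a', b'⟩ hab' h
      rw [Finset.mem_coe, Finset.mem_product] at hab hab'
      have h' : a + b = a' + b' := h
      have := hW i a hab.1 a' hab'.1 b hab.2 b' hab'.2 (by linear_combination h')
      exact Prod.ext this.1 this.2
    -- `m₀ ≤ n ≤ n^(2-ε') ≤ |A 0| |B 0| ≤ p`
    have hm₀ : m₀ ≤ p := by
      have i₀ : Fin n := ⟨0, hn1⟩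
      have h1 : (n : ℝ) ≤ (n : ℝ) ^ (2 - ε') := by
        calc (n : ℝ) = (n : ℝ) ^ (1 : ℝ) := (Real.rpow_one _).symm
          _ ≤ (n : ℝ) ^ (2 - ε') := Real.rpow_le_rpow_of_exponent_le hn1R (by linarith)
      have h2 : (n : ℝ) ≤ (p : ℝ) := (h1.trans (hAB i₀)).trans (by exact_mod_cast hdir i₀)
      have h3 : n ≤ p := by exact_mod_cast h2
      exact le_trans (le_trans (le_max_left _ _) hn) h3
    -- `p^(1/(2+ε')) ≤ n`
    have h2e : (2 + ε') ≠ 0 := (by linarith : (0 : ℝ) < 2 + ε').ne'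
    have hroot : (p : ℝ) ^ (1 / (2 + ε')) ≤ n := by
      have h1 : (p : ℝ) ^ (1 / (2 + ε')) ≤ ((n : ℝ) ^ (2 + ε')) ^ (1 / (2 + ε')) :=
        Real.rpow_le_rpow hp0 hpn (by positivity)
      rw [one_div, Real.rpow_rpow_inv hn0 h2e] at h1
      rwa [one_div]
    refine ⟨p, hm₀, n, A, B, ⟨hW, ?_⟩, ?_, fun c => ?_⟩
    · -- (ii) from clause (X) at `(i, j, k) = (p', c, q)`
      intro c p' q hpq x hx y hy x' hx' y' hy' heq
      exact (ne_of_lt hpq) (hX p' c q x' hx' x hx y hy y' hy' (by linear_combination heq))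
    · -- `p^(1/2-ε) ≤ p^(1/(2+ε')) ≤ n`
      have hexp : 1 / 2 - ε ≤ 1 / (2 + ε') := by
        rw [le_div_iff₀ (by linarith)]
        nlinarith [mul_pos hε hε']
      exact (Real.rpow_le_rpow_of_exponent_le hp1 hexp).trans hroot
    · -- `p^(1-ε) ≤ (p^(1/(2+ε')))^(2-ε') ≤ n^(2-ε') ≤ |A c| |B c|`
      have hexp : 1 - ε ≤ (1 / (2 + ε')) * (2 - ε') := by
        rw [one_div, inv_mul_eq_div, le_div_iff₀ (by linarith)]
        nlinarith [mul_pos hε hε']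
      calc (p : ℝ) ^ (1 - ε) ≤ (p : ℝ) ^ ((1 / (2 + ε')) * (2 - ε')) := Real.rpow_le_rpow_of_exponent_le hp1 hexp
        _ = ((p : ℝ) ^ (1 / (2 + ε'))) ^ (2 - ε') := Real.rpow_mul hp0 _ _
        _ ≤ (n : ℝ) ^ (2 - ε') := Real.rpow_le_rpow (by positivity) hroot (by linarith)
        _ ≤ _ := hAB c
  · /- (⇐): the slice `1/K ≤ δ` from one ladder level, `K = max 2 ⌈1/δ⌉₊` -/
    obtain ⟨K, hK2, hKδ⟩ : ∃ K : ℕ, 2 ≤ K ∧ 1 / (K : ℝ) ≤ δ := by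
      refine ⟨max 2 ⌈1 / δ⌉₊, le_max_left _ _, ?_⟩
      have h1 : 1 / δ ≤ (⌈1 / δ⌉₊ : ℝ) := Nat.le_ceil _
      have h2 : (⌈1 / δ⌉₊ : ℝ) ≤ ((max 2 ⌈1 / δ⌉₊ : ℕ) : ℝ) := by exact_mod_cast le_max_right _ _
      calc 1 / ((max 2 ⌈1 / δ⌉₊ : ℕ) : ℝ) ≤ 1 / (1 / δ) := one_div_le_one_div_of_le (by positivity) (h1.trans h2)
        _ = δ := one_div_one_div δ
    have hK0 : (0 : ℝ) < K := by exact_mod_cast (by omega : 0 < K)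
    have hε : (0 : ℝ) < 1 / (12 * (K : ℝ)) := div_pos one_pos (by positivity)
    obtain ⟨m, hm, r, X, Y, ⟨hW, hL⟩, hr, hP⟩ := hC (1 / (12 * (K : ℝ))) hε (n₀ + 2 * 4 ^ (14 * K + 6) + (14 * K + 6))
    haveI : NeZero m := ⟨by omega⟩
    obtain ⟨p, hp, A, B, hWA, hXA, hpn, hAB⟩ := slice_of_ladder hK2 X Y hW hL hr hP (by omega) (by omega)
    have hm1 : 1 ≤ m := by omega
    have hn1 : (1 : ℝ) ≤ ((m ^ (7 * K) : ℕ) : ℝ) := by exact_mod_cast Nat.one_le_pow _ _ hm1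
    refine ⟨m ^ (7 * K), ?_, p, hp, A, B, hWA, hXA, ?_, fun i => ?_⟩
    · calc n₀ ≤ m := by omega
        _ = m ^ 1 := (pow_one m).symm
        _ ≤ m ^ (7 * K) := Nat.pow_le_pow_right hm1 (by omega)
    · exact hpn.trans (Real.rpow_le_rpow_of_exponent_le hn1 (by linarith))
    · exact (Real.rpow_le_rpow_of_exponent_le hn1 (by linarith)).trans (hAB i)

end Summit.MatrixMultiplication.MatrixMultiplication.Theorems.PrimeTwoFamilies.LadderElementary
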